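import Literature.Analysis.SpecialFunctions.EulerMascheroniSharpBounds
import HarnessLib

/-!
# RiemannHypothesis / GroundBarta — rung 4: a sharper Euler–Mascheroni bracket (`n = 8192`, width `2·10⁻¹⁸`)

Helper file (`--supports`), RH-free.  Prover A (gen 2).  The tree's `γ` bracket (`…_gt_d16/_lt_d16`, width `7.7·10⁻¹⁵`,
`n = 1024` in the fourth-order Euler–Maclaurin bounds of `EulerMascheroniSharpBounds`) limits the killing-constant bracket
`M_b` and hence the PSD certificates of the ladder cells with `ρ₁ ≲ 10⁻¹³` (`b ≥ 0.77`).  The same landed lemmas at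
`n = 8192` (`H₈₁₉₂` by kernel evaluation, `log 8192 = 13 log 2`) give `γ ∈ [0.5772156649015328603, 0.5772156649015328627] (width 2.4·10⁻¹⁸)`.
-/

set_option linter.dupNamespace false

noncomputable section

namespace Summit.RiemannHypothesis.RiemannHypothesis.Theorems.EvenWinsBeyondArch

open Literature.Analysis.SpecialFunctions.Real

/-- `H₈₁₉₂ > 9.58819004609530845206026334` (kernel evaluation in `ℚ`). [folklore] -/
theorem harmonic_8192_gt : (958819004609530845206026334 / 100000000000000000000000000 : ℚ) < harmonic 8192 := by
  decide +kernel

/-- `H₈₁₉₂ < 9.58819004609530845206026335`. [folklore] -/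
theorem harmonic_8192_lt : harmonic 8192 < (958819004609530845206026335 / 100000000000000000000000000 : ℚ) := by
  decide +kernel

/-- **`γ > 0.5772156649015328603`** (from `L₈₁₉₂ ≤ γ`). [folklore] -/
theorem eulerMascheroniConstant_gt_d19 : (0.5772156649015328603 : ℝ) < Real.eulerMascheroniConstant := by
  have h := harmonic_sub_log_fourth_order_le 8192 (by norm_num)
  have hH : ((958819004609530845206026334 / 100000000000000000000000000 : ℚ) : ℝ) < ((harmonic 8192 : ℚ) : ℝ) :=
    Rat.cast_lt.2 harmonic_8192_gt
  have hlog : Real.log ((8192 : ℕ) : ℝ) = 13 * Real.log 2 := by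
    rw [show ((8192 : ℕ) : ℝ) = 2 ^ 13 by norm_num, Real.log_pow]; norm_num
  have h2 := log_two_lt_d20
  have e1 : (1 : ℝ) / (2 * ((8192 : ℕ) : ℝ)) = 1 / 16384 := by norm_num
  have e2 : (1 : ℝ) / (12 * ((8192 : ℕ) : ℝ) ^ 2) = 1 / 805306368 := by norm_num
  have e4 : (1 : ℝ) / (120 * ((8192 : ℕ) : ℝ) ^ 4) = 1 / 540431955284459520 := by norm_num
  rw [hlog, e1, e2, e4] at h
  generalize ((harmonic 8192 : ℚ) : ℝ) = H at h hH
  push_cast at hH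
  linarith

/-- **`γ < 0.5772156649015328627`** (from `γ ≤ U₈₁₉₂ = L₈₁₉₂ + 1.85·10⁻¹⁸`). [folklore] -/
theorem eulerMascheroniConstant_lt_d19 : Real.eulerMascheroniConstant < 0.5772156649015328627 := by
  have h := le_harmonic_sub_log_fourth_order 8192 (by norm_num)
  have hH : ((harmonic 8192 : ℚ) : ℝ) < ((958819004609530845206026335 / 100000000000000000000000000 : ℚ) : ℝ) :=
    Rat.cast_lt.2 harmonic_8192_lt
  have hlog : Real.log ((8192 : ℕ) : ℝ) = 13 * Real.log 2 := by
    rw [show ((8192 : ℕ) : ℝ) = 2 ^ 13 by norm_num, Real.log_pow]; norm_num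
  have h2 := log_two_gt_d20
  have e1 : (1 : ℝ) / (2 * ((8192 : ℕ) : ℝ)) = 1 / 16384 := by norm_num
  have e2 : (1 : ℝ) / (12 * ((8192 : ℕ) : ℝ) ^ 2) = 1 / 805306368 := by norm_num
  rw [hlog, e1, e2] at h
  generalize ((harmonic 8192 : ℚ) : ℝ) = H at h hH
  push_cast at hH
  linarith

end Summit.RiemannHypothesis.RiemannHypothesis.Theorems.EvenWinsBeyondArch

end
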